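import Summits.HodgeConjecture.HodgeConjecture.Theorems.Ring2HypothesesDescent
import Literature.AlgebraicGeometry.HodgeTheory.MotivatedClassesHodgeClassesHolds
import HarnessLib

/-!
# Ring 2 — hypotheses layer, part XXV: the André §2.5 c) binder of the descent rows is now THEOREM-FED

HONEST FRAMING (page 1, unchanged): research route conditional on HC_CM; not a corollary; Q11.4-sentence-2
already refuted in dim ≥ 3. `HC_CM` is the binder `Theses.RankFourFaces.CMAbelianHodge`, referred to BY NAME,
always an ARGUMENT, never a fact. Nothing in this file asserts `HC_CM`, `HC_AV` or `HodgeConjecture`.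

WHAT. Part III (`Ring2HypothesesDescent`, rows (C3)) priced the motivated-cycles reading of the two open arrows:
`HC_AV ⟹ MotivatedImpliesAlgebraicAV`, `HodgeConjecture ⟹ MotivatedImpliesAlgebraic` and
`HC_AV ⟺ MotivatedImpliesAlgebraicAV` were stated MODULO the named fact
`Andre1996_motivatedClasses_le_span_hodgeClasses` (André 1996, §2.5 c): every motivated class lies in the `ℂ`-span
of the Hodge classes), carried as the binder `hMH`. That fact is now a TREE THEOREM,
`Literature.AlgebraicGeometry.HodgeTheory.Andre1996_motivatedClasses_le_span_hodgeClasses_holds`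
(`Literature/AlgebraicGeometry/HodgeTheory/MotivatedClassesHodgeClassesHolds.lean`, proved from the generators of
André's Déf. 1: algebraic classes, the Lefschetz involution, cup product and Gysin push-forward preserve the Hodge
span). This file feeds it, so the three rows lose the binder:

* `motivatedImpliesAlgebraicAV_of_hc_av_holds : HC_AV → MotivatedImpliesAlgebraicAV` — ON-PATH, fact-free;
* `motivatedImpliesAlgebraic_of_hodgeConjecture_holds : HodgeConjecture → MotivatedImpliesAlgebraic` — ON-PATH,
  fact-free;
* `hc_av_iff_motivatedImpliesAlgebraicAV_holds (hAM) : HC_AV ↔ MotivatedImpliesAlgebraicAV` — now modulo ONE named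
  fact, André's Thm. 0.6.2 (`Andre1996_hodgeClasses_abelianVariety_motivated`: Hodge classes on abelian varieties are
  motivated), which stays a hypothesis;
* nothing on the `HC_CM` side is added: on this row `HC_CM` is a CONSEQUENCE modulo the one remaining fact
  (`hc_cm_of_andre_of_motivatedImpliesAlgebraicAV`, part III, binder `hAM` only), unchanged.

Consumption status of the node `MotivatedImpliesAlgebraicAV` in the hypotheses-axis census (gen 14): ON-PATH
modulo NOTHING (was: modulo [hMH]). The part-III theorems with the binder stay (append-only); downstream users
(`Ring2AbelianAllLefschetzPencils` l.300) may pass `Andre1996_motivatedClasses_le_span_hodgeClasses_holds` for `hMH`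
or use the `_holds` forms below.

Sources: [cite: Andre1996Motifs, §2.5 c) (p. 18), §2.1 Déf. 1 (p. 14), Thm. 0.4, Thm. 0.6.2]. No `sorry`, no new
axiom; every theorem is a one-line instantiation. -/

-- The summit's namespace repeats `HodgeConjecture` (summit = sub-problem); every file of the axis disables this linter.
set_option linter.dupNamespace false

namespace Summit.HodgeConjecture.HodgeConjecture.Ring2.Hypotheses

open Literature.AlgebraicGeometry.HodgeTheory

/-- ON-PATH, fact-free (was modulo `hMH`, part III): `HC_AV ⟹ MotivatedImpliesAlgebraicAV`, the André §2.5 c)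
input fed by the tree theorem `Andre1996_motivatedClasses_le_span_hodgeClasses_holds`.
[cite: Andre1996Motifs, §2.5 c) (p. 18) and Thm. 0.4] -/
theorem motivatedImpliesAlgebraicAV_of_hc_av_holds (h : Theses.PadicSemiregularLift.HodgeAbelianVarieties) :
    MotivatedImpliesAlgebraicAV :=
  motivatedImpliesAlgebraicAV_of_hc_av Andre1996_motivatedClasses_le_span_hodgeClasses_holds h

/-- ON-PATH, fact-free (was modulo `hMH`, part III): `HodgeConjecture ⟹ MotivatedImpliesAlgebraic`.
[cite: Andre1996Motifs, §2.5 c) (p. 18) and Thm. 0.4] -/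
theorem motivatedImpliesAlgebraic_of_hodgeConjecture_holds (h : _root_.HodgeConjecture) :
    MotivatedImpliesAlgebraic :=
  motivatedImpliesAlgebraic_of_hodgeConjecture Andre1996_motivatedClasses_le_span_hodgeClasses_holds h

/-- `HC_AV ⟺ MotivatedImpliesAlgebraicAV` modulo ONE named fact (André's Thm. 0.6.2, Hodge classes on abelian
varieties are motivated — a hypothesis `hAM`, not asserted); the second fact of part III's
`hc_av_iff_motivatedImpliesAlgebraicAV_of_andre` is now theorem-fed. Neither side is asserted.
[cite: Andre1996Motifs, Thm. 0.6.2 and §2.5 c) (p. 18)] -/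
theorem hc_av_iff_motivatedImpliesAlgebraicAV_holds (hAM : Andre1996_hodgeClasses_abelianVariety_motivated) :
    Theses.PadicSemiregularLift.HodgeAbelianVarieties ↔ MotivatedImpliesAlgebraicAV :=
  hc_av_iff_motivatedImpliesAlgebraicAV_of_andre hAM Andre1996_motivatedClasses_le_span_hodgeClasses_holds

end Summit.HodgeConjecture.HodgeConjecture.Ring2.Hypotheses
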